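import Summits.Ventures.HSemireg.WedgeHankelRecurrenceGaussZerosUniformBound

/-!
# Venture HSemireg — **THE KERNEL POLYNOMIALS AT `0` IN STIELTJES' COORDINATES AND RUTISHAUSER'S qd RHOMBUS RULES**: for birth–death data `a_n = λ_n + μ_n`, `b_{n+1} = λ_n μ_{n+1}` (`μ_0 = 0`,
# all `λ_n, μ_{n+1} > 0`) one has `q_{n+1}(0) = −λ_n q_n(0)`, and the monic kernel polynomials `X p_n = q_{n+1} + λ_n q_n` satisfy the DUAL recurrence `ã_n = λ_n + μ_{n+1}`,
# `b̃_{n+1} = λ_{n+1} μ_{n+1}` (Galant N375 at `κ = 0`; the `LU → UL` exchange); all zeros of every `p_{t+1}` are positive (Wall–Wetzel N372 with `g_n = λ_n∕(λ_n + μ_{n+1})`), and the normalized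
# parameters `(λ', μ')` of `(ã, b̃)` obey the qd RHOMBUS RULES `λ'_n + μ'_n = λ_n + μ_{n+1}`, `λ'_n μ'_{n+1} = λ_{n+1} μ_{n+1}`; LAGUERRE: the kernel polynomials of `L^{(α)}` at `0` are `L^{(α+1)}`

HONEST FRAMING. Part of the Lean index of the computation cell `pub-hsemireg` (seat p10 gen 46, Sunday typer «UNIFORM-IN-n»).  Real polynomials and finite products only; no variety, no cohomology
theory, no sheaf, no Ext group and no semiregularity map is constructed here; nothing here says that HC / HC_CM / HC_AV holds; no Literature fact (unproved `Prop`) is declared or used.  Custodian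
versions as in `WedgeHankelSiegelIdeal` (1/3).
SOURCES (cited).  H. Rutishauser, *Der Quotienten-Differenzen-Algorithmus*, Z. Angew. Math. Phys. 5 (1954) 233–251 (rhombus rules); P. Henrici, *Applied and Computational Complex Analysis* I
(1974) §7.6; T. S. Chihara, *An Introduction to Orthogonal Polynomials* (1978), Ch. I §7 Thm 7.1–7.2 (kernel polynomials, their zeros) and §9 (9.5)–(9.9); W. Gautschi, *Orthogonal Polynomials:
Computation and Approximation* (2004), §2.4.2 and §3.1 (LR ∕ qd steps); G. Szegő, *Orthogonal Polynomials*, (5.1.13)–(5.1.14) (`L_n^{(α+1)}` from `L_n^{(α)}`, `L_{n+1}^{(α)}`).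
PROOF TYPED HERE.  `q_{n+1}(0) = −λ_n q_n(0)` from N373 `recurrence_alt_eval_zero_of_birthDeath`; N375 `kernel_polynomial_recurrence` with `r_n = −λ_n`, `ã_n = a_{n+1} + r_{n+1} − r_n = λ_n + μ_{n+1}`,
`b̃_{n+1} r_n = b_{n+1} r_{n+1}`; the zeros by N372 `zeros_gt_of_chain` (`A = 0`, equality in the comparison); the rhombus rules are the two ways of writing `(ã, b̃)`.
DEDUP DISCLOSURE (`rg -n -i 'rhombus|quotient.difference|qd_|rutishauser' Summits/Ventures/HSemireg Literature`, 2026-09-03): nothing.  The 6 names below: 0 hits tree-wide.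

WHAT IS IN THE TREE.  N373 `recurrence_alt_eval_zero_of_birthDeath`; N375 `kernel_polynomial_recurrence`; N372 `zeros_gt_of_chain`; N360 `recurrence_of_coefficients`; N376 (Laguerre data).
THIS FILE (namespace `Summit.Ventures.HSemireg.Wedge.HankelOuter` continued; CHAINED on N379 (import only); 0 definitions):
* §1145 `birthDeath_eval_zero_succ` (`q_{n+1}(0) = −λ_n q_n(0) ≠ 0`), `kernel_polynomial_exists_zero` (global existence of the `p_n`), **`kernel_recurrence_birthDeath_dual`** (`p` solves the
  recurrence `(λ_n + μ_{n+1}, λ_{n+1} μ_{n+1})`), **`kernel_recurrence_zeros_pos`**, **`qd_rhombus_rules`**, `laguerre_kernel_succ` (`X · L_n^{(α+1)} = L_{n+1}^{(α)} + (n+1+α) L_n^{(α)}`: the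
  Laguerre(`α`) kernel polynomials at `0` solve the Laguerre(`α+1`) recurrence).
CAVEATS.  Globally positive parameters (`λ_n > 0`, `μ_{n+1} > 0` for all `n`) for simplicity; end point `κ = 0` only (general `κ` is N375 after a translation).  Nothing Ext-side.  New names only.
-/

open Module Polynomial
open scoped Matrix Polynomial

namespace Summit.Ventures.HSemireg.Wedge.HankelOuter

/-! ## §1145. Kernel polynomials at `0` and the qd rhombus rules -/

/-- **`q_{n+1}(0) = −λ_n q_n(0)` and `q_n(0) ≠ 0`** for global birth–death data. [Chihara I (9.5); this file, §1145] -/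
theorem birthDeath_eval_zero_succ {q : ℕ → ℝ[X]} {a b l m : ℕ → ℝ} (hq0 : q 0 = 1) (hq1 : q 1 = Polynomial.X - C (a 0))
    (hrec : ∀ n, q (n + 2) = (Polynomial.X - C (a (n + 1))) * q (n + 1) - C (b (n + 1)) * q n) (hm0 : m 0 = 0) (hl : ∀ n, 0 < l n)
    (ha : ∀ n, a n = l n + m n) (hbn : ∀ n, b (n + 1) = l n * m (n + 1)) (n : ℕ) :
    (q (n + 1)).eval 0 = -l n * (q n).eval 0 ∧ (q n).eval 0 ≠ 0 := by
  have h0 := recurrence_alt_eval_zero_of_birthDeath hq0 hq1 hrec (t := n + 1) hm0 (fun k _ => ha k) (fun k _ => hbn k) n (by omega)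
  have h1 := recurrence_alt_eval_zero_of_birthDeath hq0 hq1 hrec (t := n + 1) hm0 (fun k _ => ha k) (fun k _ => hbn k) (n + 1) (by omega)
  rw [Finset.prod_range_succ, ← h0, pow_succ] at h1
  have hpow : (-1 : ℝ) ^ n ≠ 0 := pow_ne_zero _ (by norm_num)
  refine ⟨?_, fun hz => ?_⟩
  · apply mul_left_cancel₀ hpow
    linear_combination (-1 : ℝ) * h1
  · rw [hz, mul_zero] at h0
    exact (Finset.prod_pos fun k _ => hl k).ne' h0.symm

/-- **The kernel polynomials at `0` exist globally: `X · p_n = q_{n+1} + λ_n q_n`.** [bookkeeping; this file, §1145] -/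
theorem kernel_polynomial_exists_zero {q : ℕ → ℝ[X]} {a b l m : ℕ → ℝ} (hq0 : q 0 = 1) (hq1 : q 1 = Polynomial.X - C (a 0))
    (hrec : ∀ n, q (n + 2) = (Polynomial.X - C (a (n + 1))) * q (n + 1) - C (b (n + 1)) * q n) (hm0 : m 0 = 0) (hl : ∀ n, 0 < l n)
    (ha : ∀ n, a n = l n + m n) (hbn : ∀ n, b (n + 1) = l n * m (n + 1)) :
    ∃ p : ℕ → ℝ[X], ∀ n, (Polynomial.X - C (0 : ℝ)) * p n = q (n + 1) - C (-l n) * q n := by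
  refine ⟨fun n => (q (n + 1) - C (-l n) * q n) /ₘ (Polynomial.X - C (0 : ℝ)), fun n => ?_⟩
  rw [mul_divByMonic_eq_iff_isRoot, IsRoot, eval_sub, eval_mul, eval_C, (birthDeath_eval_zero_succ hq0 hq1 hrec hm0 hl ha hbn n).1, sub_self]

/-- **THE DUAL RECURRENCE OF THE KERNEL POLYNOMIALS AT `0`: `p_0 = 1`, `p_1 = X − (λ_0 + μ_1)`, `p_{n+2} = (X − (λ_{n+1} + μ_{n+2})) p_{n+1} − λ_{n+1} μ_{n+1} p_n`** (Galant's step N375 at `κ = 0` with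
`r_n = −λ_n`). [Chihara I §9 (9.5)–(9.9); Gautschi §2.4.2; this file, §1145] -/
theorem kernel_recurrence_birthDeath_dual {q p : ℕ → ℝ[X]} {a b l m : ℕ → ℝ} (hq0 : q 0 = 1) (hq1 : q 1 = Polynomial.X - C (a 0))
    (hrec : ∀ n, q (n + 2) = (Polynomial.X - C (a (n + 1))) * q (n + 1) - C (b (n + 1)) * q n) (hm0 : m 0 = 0) (hl : ∀ n, 0 < l n)
    (ha : ∀ n, a n = l n + m n) (hbn : ∀ n, b (n + 1) = l n * m (n + 1)) (hp : ∀ n, (Polynomial.X - C (0 : ℝ)) * p n = q (n + 1) - C (-l n) * q n) :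
    p 0 = 1 ∧ p 1 = Polynomial.X - C (l 0 + m 1) ∧ ∀ n, p (n + 2) = (Polynomial.X - C (l (n + 1) + m (n + 2))) * p (n + 1) - C (l (n + 1) * m (n + 1)) * p n := by
  have hev := fun n => birthDeath_eval_zero_succ hq0 hq1 hrec hm0 hl ha hbn n
  have hr : ∀ n, -l n * (q n).eval 0 = (q (n + 1)).eval 0 := fun n => (hev n).1.symm
  have key : ∀ N, p 0 = 1 ∧ p 1 = Polynomial.X - C (l 0 + m (0 + 1)) ∧
      ∀ n, n + 1 ≤ N → p (n + 2) = (Polynomial.X - C (l (n + 1) + m (n + 1 + 1))) * p (n + 1) - C (l (n + 1) * m (n + 1)) * p n := fun N =>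
    kernel_polynomial_recurrence hq0 hq1 hrec (N := N) (κ := 0) (r := fun n => -l n) (A := fun n => l n + m (n + 1)) (Bt := fun n => l n * m n)
      (fun n _ => (hev n).2) (fun n _ => hr n) (fun n _ => hp n) (fun n => by rw [ha]; ring) (fun n => by rw [hbn]; ring)
  refine ⟨(key 0).1, by rw [(key 0).2.1], fun n => ?_⟩
  rw [(key (n + 1)).2.2 n le_rfl]

/-- **ALL ZEROS OF THE KERNEL POLYNOMIALS ARE POSITIVE**: every zero of `p_{t+1}` (dual recurrence `(λ_n + μ_{n+1}, λ_{n+1} μ_{n+1})`, any positive `b'_0`) is `> 0` — Wall–Wetzel at `A = 0`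
with the explicit parameters `g_n = λ_n∕(λ_n + μ_{n+1})` (equality in the comparison). [Chihara I Thm 7.2; this file, §1145] -/
theorem kernel_recurrence_zeros_pos {p : ℕ → ℝ[X]} {a' b' l m : ℕ → ℝ} (hp0 : p 0 = 1) (hp1 : p 1 = Polynomial.X - C (a' 0))
    (hprec : ∀ n, p (n + 2) = (Polynomial.X - C (a' (n + 1))) * p (n + 1) - C (b' (n + 1)) * p n) (hl : ∀ n, 0 < l n) (hm : ∀ n, 0 < m (n + 1))
    (hA : ∀ n, a' n = l n + m (n + 1)) (hB : ∀ n, b' (n + 1) = l (n + 1) * m (n + 1)) (hB0 : 0 < b' 0) (t : ℕ) : ∀ s, (p (t + 1)).eval s = 0 → 0 < s := by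
  have hBpos : ∀ j, 0 < b' j := fun j => by
    rcases j with _ | k
    · exact hB0
    · rw [hB]; exact mul_pos (hl _) (hm _)
  refine zeros_gt_of_chain hp0 hp1 hprec hBpos (A := 0) (g := fun n => l n / (l n + m (n + 1))) (fun n _ => by rw [hA]; exact add_pos (hl n) (hm n))
    (fun n _ => ⟨div_nonneg (hl n).le (add_pos (hl n) (hm n)).le, (div_lt_one (add_pos (hl n) (hm n))).2 (by linarith [hm n])⟩) fun n _ => le_of_eq ?_
  have h0 : l n + m (n + 1) ≠ 0 := (add_pos (hl n) (hm n)).ne'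
  have h1 : l (n + 1) + m (n + 1 + 1) ≠ 0 := (add_pos (hl (n + 1)) (hm (n + 1))).ne'
  rw [hB, hA, hA, sub_zero, sub_zero]
  field_simp
  ring

/-- **RUTISHAUSER'S qd RHOMBUS RULES**: if `(λ', μ')` are birth–death parameters of the dual (kernel) recurrence `ã_n = λ_n + μ_{n+1}`, `b̃_{n+1} = λ_{n+1} μ_{n+1}` — i.e. `ã_n = λ'_n + μ'_n`,
`b̃_{n+1} = λ'_n μ'_{n+1}` — then `λ'_n + μ'_n = λ_n + μ_{n+1}` and `λ'_n μ'_{n+1} = λ_{n+1} μ_{n+1}` (`e' + q' = q + e`, `q' e' = e q`). [Rutishauser 1954; Henrici §7.6; this file, §1145] -/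
theorem qd_rhombus_rules {a' b' l m l' m' : ℕ → ℝ} (hA : ∀ n, a' n = l n + m (n + 1)) (hB : ∀ n, b' (n + 1) = l (n + 1) * m (n + 1))
    (hA' : ∀ n, a' n = l' n + m' n) (hB' : ∀ n, b' (n + 1) = l' n * m' (n + 1)) (n : ℕ) :
    l' n + m' n = l n + m (n + 1) ∧ l' n * m' (n + 1) = l (n + 1) * m (n + 1) :=
  ⟨by rw [← hA', hA], by rw [← hB', hB]⟩

/-- **LAGUERRE: the kernel polynomials of `L^{(α)}` at `0` solve the `L^{(α+1)}` recurrence** — with `X · p_n = L_{n+1}^{(α)} + (n + 1 + α) L_n^{(α)}` (`α > −1`): `p_0 = 1`, `p_1 = X − (2·0 + 1 + (α+1))`,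
`p_{n+2} = (X − (2(n+1) + 1 + (α+1))) p_{n+1} − (n+1)(n+1+(α+1)) p_n`. [Szegő (5.1.13)–(5.1.14); this file, §1145] -/
theorem laguerre_kernel_succ {L p : ℕ → ℝ[X]} {a b : ℕ → ℝ} {α : ℝ} (hL0 : L 0 = 1) (hL1 : L 1 = Polynomial.X - C (a 0))
    (hLrec : ∀ n, L (n + 2) = (Polynomial.X - C (a (n + 1))) * L (n + 1) - C (b (n + 1)) * L n) (ha : ∀ n, a n = 2 * n + 1 + α)
    (hb : ∀ n, b (n + 1) = ((n : ℝ) + 1) * ((n : ℝ) + 1 + α)) (hα : -1 < α) (hp : ∀ n, Polynomial.X * p n = L (n + 1) + C ((n : ℝ) + 1 + α) * L n) :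
    p 0 = 1 ∧ p 1 = Polynomial.X - C (2 * ((0 : ℕ) : ℝ) + 1 + (α + 1)) ∧
      ∀ n, p (n + 2) = (Polynomial.X - C (2 * (((n + 1 : ℕ)) : ℝ) + 1 + (α + 1))) * p (n + 1) - C ((((n : ℕ) : ℝ) + 1) * (((n : ℕ) : ℝ) + 1 + (α + 1))) * p n := by
  have hl : ∀ n : ℕ, (0 : ℝ) < n + 1 + α := fun n => by have : (0 : ℝ) ≤ n := Nat.cast_nonneg n; linarith
  have hp' : ∀ n, (Polynomial.X - C (0 : ℝ)) * p n = L (n + 1) - C (-((n : ℝ) + 1 + α)) * L n := fun n => by rw [C_0, sub_zero, hp n, map_neg]; ring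
  obtain ⟨h0, h1, h2⟩ := kernel_recurrence_birthDeath_dual hL0 hL1 hLrec (l := fun k => (k : ℝ) + 1 + α) (m := fun k => (k : ℝ)) (by simp) hl
    (fun k => by rw [ha]; ring) (fun k => by rw [hb]; push_cast; ring) hp'
  refine ⟨h0, by rw [h1]; push_cast; ring_nf, fun n => ?_⟩
  rw [h2 n]
  push_cast
  ring_nf

end Summit.Ventures.HSemireg.Wedge.HankelOuter
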